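import Literature.MathematicalPhysics.QuantumLattice.HubbardUVSymbolSmooth
import Mathlib.Analysis.Calculus.ContDiff.Bounds
import HarnessLib

/-!
# All-order band jets of the ultraviolet WEIGHT `e ↦ w(ω, e) = χ₂((ω² + e²)/Λ²)`: `‖∂_eⁿ w‖ ≤ n!·X·(2|e|/Λ² + 2/Λ)ⁿ` from the cutoff jets `‖χ₂^{(l)}‖ ≤ X`

Topic `MathematicalPhysics/QuantumLattice`; cell gate-hubbard-kl, K3 gen-8-flow S6 door (2) (design memo `HOME/p2-g10/JET-RESPONSE-DESIGN-p2g10.md`, item L2a):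
the one-shot covariance symbol is `Ψ = w·R` (`uvSymbolFnXi`, `HubbardUVSymbolSmooth`); the all-order jets of `R` are `HubbardResolventJets`; here the weight.
Faà di Bruno (Mathlib `norm_iteratedFDeriv_comp_le`) on `χ₂ ∘ q`, `q(e) = (e² + ω²)/Λ²`, whose band derivatives are `2e/Λ²`, `2/Λ²`, `0, 0, …`, all `≤ D(e)^i` for
`D(e) := 2|e|/Λ² + 2/Λ`:

* `uvWeightFn_band_eq` — `uvWeightFn Λ ω e = χ₂((e² + ω²)/Λ²)` (`rfl`); `contDiff_uvWeightFn_band`;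
* `iteratedDeriv_bandQuad_one/_two/_add_three` — the jets of `q`;
* **`norm_iteratedFDeriv_uvWeightFn_band_le`** — for `0 < Λ` and cutoff jets `‖iteratedFDeriv ℝ l χ₂ x‖ ≤ X` (`l ≤ n`):
  `‖iteratedFDeriv ℝ n (fun e => uvWeightFn Λ ω e) e‖ ≤ n!·X·(2|e|/Λ² + 2/Λ)ⁿ` at EVERY `e`; on the shell `|e| ≤ Λ` this is `≤ n!·X·(4/Λ)ⁿ`
  (`norm_iteratedFDeriv_uvWeightFn_band_le_of_abs_le`).

The cutoff-jet constant `X` is a HYPOTHESIS (Summits: `exists_norm_iteratedFDeriv_salmhoferCutoff_le_all`).  Everything is proved; no definitions; no named facts.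

## Sources

G. Benfatto, A. Giuliani, V. Mastropietro, Ann. Henri Poincaré 7 (2006) 809–898, §2.2 (2.36aa), footnote ¹ [`BenfattoGiulianiMastropietro2006`];
M. Salmhofer, *Renormalization* (1999), §4.2.4 (4.63) [`Salmhofer1999`].
-/

noncomputable section

namespace Literature.MathematicalPhysics.QuantumLattice

open scoped Nat

variable {Λ ω : ℝ}

/-- The weight read in the band variable: `uvWeightFn Λ ω e = χ₂((e² + ω²)/Λ²)`. [cite: Salmhofer1999, §4.2.4 (4.63)] -/
theorem uvWeightFn_band_eq (Λ ω e : ℝ) : uvWeightFn Λ ω e = salmhoferCutoff ((e ^ 2 + ω ^ 2) / Λ ^ 2) := rfl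

/-- The inner quadratic is `C^∞`. [cite: Salmhofer1999, §4.2.4 (4.63)] -/
theorem contDiff_bandQuad (Λ ω : ℝ) {N : WithTop ℕ∞} : ContDiff ℝ N (fun e : ℝ => (e ^ 2 + ω ^ 2) / Λ ^ 2) :=
  ((contDiff_id.pow 2).add contDiff_const).div_const _

/-- The weight is `C^∞` in the band. [cite: Salmhofer1999, §4.2.4 (4.63)] -/
theorem contDiff_uvWeightFn_band (Λ ω : ℝ) {N : ℕ∞} : ContDiff ℝ N (fun e : ℝ => uvWeightFn Λ ω e) :=
  (contDiff_salmhoferCutoff (n := N)).comp (contDiff_bandQuad Λ ω)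

/-- `q′(e) = 2e/Λ²`. [cite: Salmhofer1999, §4.2.4 (4.63)] -/
theorem deriv_bandQuad (Λ ω : ℝ) : deriv (fun e : ℝ => (e ^ 2 + ω ^ 2) / Λ ^ 2) = fun e => 2 * e / Λ ^ 2 := by
  funext e
  have h : HasDerivAt (fun e : ℝ => (e ^ 2 + ω ^ 2) / Λ ^ 2) (2 * e / Λ ^ 2) e := by
    have h1 : HasDerivAt (fun e : ℝ => e ^ 2) (2 * e) e := by simpa using hasDerivAt_pow 2 e
    exact (h1.add_const (ω ^ 2)).div_const (Λ ^ 2)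
  rw [h.deriv]

/-- `iteratedDeriv 1 q = 2e/Λ²`. [cite: Salmhofer1999, §4.2.4 (4.63)] -/
theorem iteratedDeriv_bandQuad_one (Λ ω : ℝ) : iteratedDeriv 1 (fun e : ℝ => (e ^ 2 + ω ^ 2) / Λ ^ 2) = fun e => 2 * e / Λ ^ 2 := by
  rw [iteratedDeriv_one, deriv_bandQuad]

/-- `iteratedDeriv 2 q = 2/Λ²`. [cite: Salmhofer1999, §4.2.4 (4.63)] -/
theorem iteratedDeriv_bandQuad_two (Λ ω : ℝ) : iteratedDeriv 2 (fun e : ℝ => (e ^ 2 + ω ^ 2) / Λ ^ 2) = fun _ => 2 / Λ ^ 2 := by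
  rw [iteratedDeriv_succ, iteratedDeriv_bandQuad_one]
  funext e
  have h : HasDerivAt (fun e : ℝ => 2 * e / Λ ^ 2) (2 * 1 / Λ ^ 2) e := ((hasDerivAt_id e).const_mul 2).div_const (Λ ^ 2)
  rw [h.deriv, mul_one]

/-- `iteratedDeriv (k+3) q = 0`. [cite: Salmhofer1999, §4.2.4 (4.63)] -/
theorem iteratedDeriv_bandQuad_add_three (Λ ω : ℝ) (k : ℕ) : iteratedDeriv (k + 3) (fun e : ℝ => (e ^ 2 + ω ^ 2) / Λ ^ 2) = fun _ => 0 := by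
  induction k with
  | zero =>
      rw [show (0 + 3 : ℕ) = 2 + 1 from rfl, iteratedDeriv_succ, iteratedDeriv_bandQuad_two]
      funext e
      exact deriv_const e _
  | succ k ih =>
      rw [show k + 1 + 3 = (k + 3) + 1 by ring, iteratedDeriv_succ, ih]
      funext e
      exact deriv_const e _

/-- The band jets of `q` are dominated geometrically: `‖iteratedFDeriv ℝ i q e‖ ≤ (2|e|/Λ² + 2/Λ)^i` for `1 ≤ i` (`0 < Λ`). [cite: Salmhofer1999, §4.2.4 (4.63)] -/
theorem norm_iteratedFDeriv_bandQuad_le (hΛ : 0 < Λ) (ω : ℝ) {i : ℕ} (hi : 1 ≤ i) (e : ℝ) :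
    ‖iteratedFDeriv ℝ i (fun e : ℝ => (e ^ 2 + ω ^ 2) / Λ ^ 2) e‖ ≤ (2 * |e| / Λ ^ 2 + 2 / Λ) ^ i := by
  have hD0 : 0 ≤ 2 * |e| / Λ ^ 2 + 2 / Λ := by positivity
  rw [norm_iteratedFDeriv_eq_norm_iteratedDeriv]
  rcases Nat.lt_or_ge i 3 with hlt | hge
  · interval_cases i
    · rw [iteratedDeriv_bandQuad_one, pow_one, Real.norm_eq_abs, abs_div, abs_mul, abs_of_pos (by norm_num : (0:ℝ) < 2),
        abs_of_pos (show (0:ℝ) < Λ ^ 2 by positivity)]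
      linarith [show (0:ℝ) ≤ 2 / Λ by positivity]
    · rw [iteratedDeriv_bandQuad_two, Real.norm_eq_abs, abs_of_pos (by positivity)]
      have h1 : 2 / Λ ^ 2 ≤ (2 / Λ) ^ 2 := by
        rw [div_pow]; exact div_le_div_of_nonneg_right (by norm_num) (by positivity)
      have h2 : (2 / Λ) ^ 2 ≤ (2 * |e| / Λ ^ 2 + 2 / Λ) ^ 2 :=
        pow_le_pow_left₀ (by positivity) (by linarith [show (0:ℝ) ≤ 2 * |e| / Λ ^ 2 by positivity]) 2
      exact h1.trans h2
  · obtain ⟨k, rfl⟩ : ∃ k, i = k + 3 := ⟨i - 3, by omega⟩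
    rw [iteratedDeriv_bandQuad_add_three]
    simp only [norm_zero]
    positivity

/-- **All-order band jets of the weight**: for `0 < Λ` and cutoff jets `‖χ₂^{(l)}‖ ≤ X` (`l ≤ n`),
`‖iteratedFDeriv ℝ n (e ↦ w(ω,e)) e‖ ≤ n!·X·(2|e|/Λ² + 2/Λ)ⁿ` at every `e`. [cite: BenfattoGiulianiMastropietro2006, §2.2 (2.36aa)] -/
theorem norm_iteratedFDeriv_uvWeightFn_band_le (hΛ : 0 < Λ) (ω : ℝ) {n : ℕ} {X : ℝ}
    (hX : ∀ l ≤ n, ∀ x : ℝ, ‖iteratedFDeriv ℝ l salmhoferCutoff x‖ ≤ X) (e : ℝ) :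
    ‖iteratedFDeriv ℝ n (fun e : ℝ => uvWeightFn Λ ω e) e‖ ≤ n ! * X * (2 * |e| / Λ ^ 2 + 2 / Λ) ^ n := by
  have hcomp : (fun e : ℝ => uvWeightFn Λ ω e) = salmhoferCutoff ∘ (fun e : ℝ => (e ^ 2 + ω ^ 2) / Λ ^ 2) := by
    funext e; rfl
  rw [hcomp]
  exact norm_iteratedFDeriv_comp_le (N := (n : ℕ∞)) (contDiff_salmhoferCutoff (n := n)) (contDiff_bandQuad Λ ω) le_rfl e
    (fun i hi => hX i hi _) (fun i hi1 hin => norm_iteratedFDeriv_bandQuad_le hΛ ω hi1 e)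

/-- **On the shell** `|e| ≤ Λ`: `‖iteratedFDeriv ℝ n (e ↦ w(ω,e)) e‖ ≤ n!·X·(4/Λ)ⁿ`. [cite: BenfattoGiulianiMastropietro2006, §2.2 (2.36aa)] -/
theorem norm_iteratedFDeriv_uvWeightFn_band_le_of_abs_le (hΛ : 0 < Λ) (ω : ℝ) {n : ℕ} {X : ℝ}
    (hX : ∀ l ≤ n, ∀ x : ℝ, ‖iteratedFDeriv ℝ l salmhoferCutoff x‖ ≤ X) {e : ℝ} (he : |e| ≤ Λ) :
    ‖iteratedFDeriv ℝ n (fun e : ℝ => uvWeightFn Λ ω e) e‖ ≤ n ! * X * (4 / Λ) ^ n := by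
  have hX0 : 0 ≤ X := (norm_nonneg _).trans (hX 0 (Nat.zero_le _) 0)
  refine (norm_iteratedFDeriv_uvWeightFn_band_le hΛ ω hX e).trans ?_
  have hD : 2 * |e| / Λ ^ 2 + 2 / Λ ≤ 4 / Λ := by
    rw [div_add_div _ _ (by positivity) hΛ.ne', div_le_div_iff₀ (by positivity) hΛ]
    nlinarith [abs_nonneg e]
  have hD0 : 0 ≤ 2 * |e| / Λ ^ 2 + 2 / Λ := by positivity
  exact mul_le_mul_of_nonneg_left (pow_le_pow_left₀ hD0 hD n) (by positivity)

end Literature.MathematicalPhysics.QuantumLattice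

end
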